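import Literature.NumberTheory.Automorphic.BCDTTheoremACasesOggTwoProofs
import Literature.NumberTheory.Automorphic.CDTTheorem722Proofs
import HarnessLib

/-!
# BCDT Theorem A by the three cases of the Introduction, with "(3) ⇒ (2)" proved from the
# catalogued classical facts

Topic `NumberTheory/Automorphic`; a `…Proofs` companion (theorems only: no definitions, no named
facts, no instances) of `Literature.NumberTheory.Automorphic.BCDTTheoremACasesOggTwoProofs`, landed
by the tenured seat of the named fact
`Literature.NumberTheory.Automorphic.exists_cuspForm_coeff_eq_frobeniusTrace` (**lang.S33**, the
weak `a_p`-form of the Modularity Theorem) to keep the switch-free assembly of that fact —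
Theorem B kept whole, no auxiliary curve, Ogg's formula for `V₂` at `p = 3` — on the finest inputs
of the tree.

C. Breuil, B. Conrad, F. Diamond, R. Taylor, *On the modularity of elliptic curves over `ℚ`: wild
`3`-adic exercises*, J. Amer. Math. Soc. 14 (2001), 843–939 [BCDTJAMS2001], Introduction (p. 845):
*"If `K` is a number field … we say that `E` is modular if … (2) `L(E, s) = L(f, s)` for some
eigenform `f` of weight `2` and level `N(E)`. (3) For some prime `ℓ`, the representation `ρ_{E,ℓ}`
is modular. … The implication (3) ⇒ (2) follows from a theorem of Carayol [Ca1] and a theorem of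
Faltings [Fa2]"*, and, on the proof of Theorem A: *"In each of cases 1 and 2 there are two steps.
First we prove that `ρ̄_{E,ℓ}` is modular and then that `ρ_{E,ℓ}` is modular. In case 1 this first
step is our Theorem B … the deduction of the modularity of `ρ_{E,ℓ}` from that of `ρ̄_{E,ℓ}` was
carried out in [CDT]"*.

`BCDTTheoremACasesOggTwoProofs` assembles Theorem A (and lang.S33) from Theorem B, CDT Thm. 7.2.1,
the two printed steps of CDT Thm. 7.2.2 — the `5`-adic lifting statement `hlift` of CDT pp. 553–554
("`ρ̄_{E,5}` modular and `ρ̄_{E,5}|_{ℚ(√5)}` absolutely irreducible ⇒ `ρ_{E,5}` modular") and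
(3) ⇒ (2) at `ℓ = 5`, `h32` — CDT Lemma 7.2.3 (modularity) and Ogg's formula for `V₂` at `p = 3`
(`BCDT.exists_isNewformOf_of_theoremB_of_CDT721_lift_32_723_of_ogg3two`), with `h32` a bare
hypothesis.  `CDTTheorem722Proofs` has since **proved (3) ⇒ (2)** (`BCDT.three_imp_two_of_facts`,
for every `ℓ`: `BCDT.isModular_of_isModularGaloisRepTate_of_facts`) from four classical results
that the tree carries as catalogued named facts:

* `hL : ∀ N, DeligneSerre1974_span_integralLattice1 N 2` — Deligne–Serre 1974, (2.7.2) in weight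
  `2` (= Shimura 1971, Thm. 3.52): `S₂(Γ₁(N))` is spanned by forms with integral `q`-expansions;
* `hES : eichlerShimuraConstruction` — the Eichler–Shimura construction (Knapp 1993, Thm. 11.74
  with Thm. 12.8);
* `hF : WeierstrassCurve.isIsogenous_iff_frobeniusTrace_eq` — Faltings' isogeny theorem (Faltings
  1983, §5 Kor. 2);
* `hC : ∀ N, IsNewformOf.level_eq_conductorNorm` — Carayol's theorem, level `=` conductor (Carayol
  1986; Diamond–Shurman Thm. 8.8.1).

This file substitutes that proof for `h32` throughout the switch-free assembly (one-line
compositions; the heavy imports of `CDTTheorem722Proofs` are kept out of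
`BCDTTheoremACasesOggTwoProofs`):

* `BCDT.isModular_of_theoremB_of_CDT721_lift_723_of_facts` — Theorem A for a given `E / ℚ` by the
  three cases, per-curve input `h27` abstract;
* `BCDT.CDT_theorem_7_1_2_of_theoremB_of_7_2_1_of_lift_of_7_2_3_of_facts` — the named fact
  `CDT_theorem_7_1_2` (no Ogg / Galois-side input at all);
* `BCDT.CDT_theorem_7_2_4_of_theoremB_of_7_2_1_of_lift_of_7_2_3_of_ogg3two_of_facts`,
  `BCDT.exists_isNewformOf_of_theoremB_of_CDT721_lift_723_of_ogg3two_of_facts` — CDT Thm. 7.2.4 and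
  **Theorem A** (`exists_isNewformOf`);
* `BCDT.exists_isNewformOf_of_serre_of_CDT721_lift_723_of_ogg3two_of_facts` — Theorem B replaced by
  Serre's conjecture (3.2.3) at `p = 5`;
* `exists_cuspForm_coeff_eq_frobeniusTrace_of_theoremB_of_CDT721_lift_723_of_ogg3two_of_facts`
  (+ the `L`-series form, + the Serre variant) — **lang.S33**.

Trust base of lang.S33 / `exists_isNewformOf` along BCDT's own proof of Theorem A after this file:
the catalogued named facts {`BCDT.theoremB` (or `exists_newform_of_odd_irreducible` at `p = 5`),
`BCDT.CDT_theorem_7_2_1`, `BCDT.CDT_lemma_7_2_3_isModular`,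
`WeierstrassCurve.swanConductorAt_rationalTate_eq_wildConductorExponent_of_ringChar_eq_three · 2`,
`DeligneSerre1974_span_integralLattice1 · 2`, `eichlerShimuraConstruction`,
`WeierstrassCurve.isIsogenous_iff_frobeniusTrace_eq`, `IsNewformOf.level_eq_conductorNorm`} and the
one printed statement `hlift` (CDT Thm. 7.2.2, proof, pp. 553–554: Thm. 7.1.1 = Thm. 5.4.2 with
Lemma 7.1.3, §2.2, §B.2, Prop. B.4.2), the part of [CDT] that needs the `p`-adic Hodge theory and
deformation theory absent from Mathlib.  Compare
`BCDT.exists_isNewformOf_of_wild_of_auxiliaryCurve_of_CDT721_lift_723_of_swan_of_facts`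
(`CDTTheorem722Proofs`), which decomposes Theorem B into its wild case and the
Shepherd-Barron–Taylor auxiliary curve and runs on Ogg's formula at `ℓ = 5` in wild form.

## References

* [BCDTJAMS2001] C. Breuil, B. Conrad, F. Diamond, R. Taylor, J. Amer. Math. Soc. 14 (2001):
  Theorem A; Introduction, p. 845 (conditions (1)–(4), "(3) ⇒ (2)"), pp. 845–846 (proof of
  Theorem A, cases 1–3).
* [ConradDiamondTaylor1999] B. Conrad, F. Diamond, R. Taylor, J. Amer. Math. Soc. 12 (1999):
  Thm. 7.1.2, Thm. 7.2.1, Thm. 7.2.2 (proof, pp. 553–554), Lemma 7.2.3, Thm. 7.2.4 (p. 556).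
* [DeligneSerreASENS1974] P. Deligne, J.-P. Serre, Ann. Sci. ÉNS 7 (1974), (2.7.2)–(2.7.4).
* [Knapp1993] A. W. Knapp, *Elliptic Curves*, Thm. 11.74, Thm. 12.8.
* [Faltings1983Endlichkeit] G. Faltings, Invent. Math. 73 (1983), §5 Korollar 2.
* [DiamondShurman2005] F. Diamond, J. Shurman, *A First Course in Modular Forms*, Thm. 8.8.1.

## Design

Theorems only; `noncomputable section`; namespaces `Literature.NumberTheory.Automorphic.BCDT`
(Theorem A / CDT forms) and `Literature.NumberTheory.Automorphic` (lang.S33 forms), as in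
`BCDTTheoremACasesOggTwoProofs`.  No new definitions, facts or instances.  Axioms of every theorem:
`propext`, `Classical.choice`, `Quot.sound`.
-/

noncomputable section

namespace Literature.NumberTheory.Automorphic.BCDT

open EllipticCurves EllipticCurves.ModularForms WeierstrassCurve GaloisRepresentations

/-! ## Theorem A with Theorem B granted and (3) ⇒ (2) proved from the catalogued facts -/

/-- **BCDT, proof of Theorem A for a given `E / ℚ`: the three cases of the Introduction, the two
steps of case 1, and "(3) ⇒ (2)" proved** — `isModular_of_theoremB_of_CDT721_lift_32_723`
(`BCDTTheoremACasesOggTwoProofs`) with its hypothesis `h32` ((3) ⇒ (2) at `ℓ = 5`) discharged by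
`three_imp_two_of_facts` (`CDTTheorem722Proofs`: Deligne–Serre (2.7.2) in weight `2`,
Eichler–Shimura, Faltings, Carayol).  Inputs: Theorem B, CDT Thm. 7.2.1, the `5`-adic lifting
statement `hlift` of CDT Thm. 7.2.2 (proof, pp. 553–554), the four classical facts, CDT Lemma 7.2.3
(modularity), and the per-curve `h27` ("`ρ̄_{E,5}|_{ℚ(√5)}` not absolutely irreducible ⇒
`27 ∤ N_E`").
[cite: BCDTJAMS2001, Introduction (proof of Theorem A, cases 1–3; (3) ⇒ (2))]
[cite: ConradDiamondTaylor1999, Thm. 7.2.2 (proof, pp. 553–554)] -/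
theorem isModular_of_theoremB_of_CDT721_lift_723_of_facts (hB : theoremB) (h721 : CDT_theorem_7_2_1)
    (hlift : ∀ (W : WeierstrassCurve ℚ) [W.IsElliptic] (ρ : ModPGaloisRep ℚ (ZMod 5) 2),
      W.IsTorsionGaloisRep 5 ρ → ρ.IsAbsIrreducibleOverSqrt 5 → ρ.IsModular →
      W.IsModularGaloisRepTate 5)
    (hL : ∀ (N : ℕ) [NeZero N], DeligneSerre1974_span_integralLattice1 N 2)
    (hES : eichlerShimuraConstruction)
    (hF : WeierstrassCurve.isIsogenous_iff_frobeniusTrace_eq)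
    (hC : ∀ (N : ℕ) [NeZero N], IsNewformOf.level_eq_conductorNorm (N := N))
    (h723 : CDT_lemma_7_2_3_isModular)
    (W : WeierstrassCurve ℚ) [W.IsElliptic] [NeZero (W.conductorNorm ℤ)]
    (h27 : ∀ ρ : ModPGaloisRep ℚ (ZMod 5) 2, W.IsTorsionGaloisRep 5 ρ →
      ¬ ρ.IsAbsIrreducibleOverSqrt 5 → ¬ 27 ∣ W.conductorNorm ℤ) :
    IsModular W :=
  isModular_of_theoremB_of_CDT721_lift_32_723 hB h721 hlift (three_imp_two_of_facts hL hES hF hC)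
    h723 W h27

/-- **Conrad–Diamond–Taylor 1999, Theorem 7.1.2** (the named fact `CDT_theorem_7_1_2`: `E / ℚ`
with `27 ∤ N_E` is modular) **from Theorem B, CDT Thm. 7.2.1, the `5`-adic lifting step of
Thm. 7.2.2, the four classical facts behind (3) ⇒ (2), and Lemma 7.2.3** — no `3`–`5` switch, no
Ogg or Galois-side input: `CDT_theorem_7_1_2_of_theoremB_of_7_2_1_of_7_2_2_of_7_2_3`
(`BCDTTheoremACasesProofs`) with `CDT_theorem_7_2_2` supplied by
`CDT_theorem_7_2_2_of_lift_of_facts` (`CDTTheorem722Proofs`).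
[cite: ConradDiamondTaylor1999, Thm. 7.1.2 and Thm. 7.2.2 (proof, pp. 553–556)]
[cite: BCDTJAMS2001, Introduction (proof of Theorem A; (3) ⇒ (2))] -/
theorem CDT_theorem_7_1_2_of_theoremB_of_7_2_1_of_lift_of_7_2_3_of_facts (hB : theoremB)
    (h721 : CDT_theorem_7_2_1)
    (hlift : ∀ (W : WeierstrassCurve ℚ) [W.IsElliptic] (ρ : ModPGaloisRep ℚ (ZMod 5) 2),
      W.IsTorsionGaloisRep 5 ρ → ρ.IsAbsIrreducibleOverSqrt 5 → ρ.IsModular →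
      W.IsModularGaloisRepTate 5)
    (hL : ∀ (N : ℕ) [NeZero N], DeligneSerre1974_span_integralLattice1 N 2)
    (hES : eichlerShimuraConstruction)
    (hF : WeierstrassCurve.isIsogenous_iff_frobeniusTrace_eq)
    (hC : ∀ (N : ℕ) [NeZero N], IsNewformOf.level_eq_conductorNorm (N := N))
    (h723 : CDT_lemma_7_2_3_isModular) :
    CDT_theorem_7_1_2 :=
  CDT_theorem_7_1_2_of_theoremB_of_7_2_1_of_7_2_2_of_7_2_3 hB h721
    (CDT_theorem_7_2_2_of_lift_of_facts hL hES hF hC hlift) h723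

/-- **Conrad–Diamond–Taylor 1999, Theorem 7.2.4** (the named fact `CDT_theorem_7_2_4`) **from
Theorem B, CDT Thm. 7.2.1, the `5`-adic lifting step of Thm. 7.2.2, the four classical facts behind
(3) ⇒ (2), Lemma 7.2.3 and Ogg's formula for `V₂` at `p = 3`**:
`CDT_theorem_7_2_4_of_theoremB_of_7_2_1_of_7_2_2_of_7_2_3_of_ogg3two`
(`BCDTTheoremACasesOggTwoProofs`) with `CDT_theorem_7_2_2` supplied by
`CDT_theorem_7_2_2_of_lift_of_facts`.
[cite: ConradDiamondTaylor1999, Thm. 7.2.4 (p. 556) and Thm. 7.2.2 (proof, pp. 553–554)] -/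
theorem CDT_theorem_7_2_4_of_theoremB_of_7_2_1_of_lift_of_7_2_3_of_ogg3two_of_facts (hB : theoremB)
    (h721 : CDT_theorem_7_2_1)
    (hlift : ∀ (W : WeierstrassCurve ℚ) [W.IsElliptic] (ρ : ModPGaloisRep ℚ (ZMod 5) 2),
      W.IsTorsionGaloisRep 5 ρ → ρ.IsAbsIrreducibleOverSqrt 5 → ρ.IsModular →
      W.IsModularGaloisRepTate 5)
    (hL : ∀ (N : ℕ) [NeZero N], DeligneSerre1974_span_integralLattice1 N 2)
    (hES : eichlerShimuraConstruction)
    (hF : WeierstrassCurve.isIsogenous_iff_frobeniusTrace_eq)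
    (hC : ∀ (N : ℕ) [NeZero N], IsNewformOf.level_eq_conductorNorm (N := N))
    (h723 : CDT_lemma_7_2_3_isModular)
    (hOgg3two : ∀ W : WeierstrassCurve ℚ,
      W.swanConductorAt_rationalTate_eq_wildConductorExponent_of_ringChar_eq_three 2) :
    CDT_theorem_7_2_4 :=
  CDT_theorem_7_2_4_of_theoremB_of_7_2_1_of_7_2_2_of_7_2_3_of_ogg3two hB h721
    (CDT_theorem_7_2_2_of_lift_of_facts hL hES hF hC hlift) h723 hOgg3two

/-- **BCDT Theorem A** (`Literature.NumberTheory.EllipticCurves.ModularForms.exists_isNewformOf`,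
the Modularity Theorem in the tree's form) **from Theorem B, CDT Thm. 7.2.1, the `5`-adic lifting
step of CDT Thm. 7.2.2, the four classical facts behind (3) ⇒ (2), CDT Lemma 7.2.3 (modularity) and
Ogg's formula for the `2`-adic Tate module at the additive places of residue characteristic `3`** —
the three cases of BCDT's Introduction for every curve, Theorem B kept whole, no `3`–`5` switch, no
auxiliary curve: `exists_isNewformOf_of_theoremB_of_CDT721_lift_32_723_of_ogg3two`
(`BCDTTheoremACasesOggTwoProofs`) with `h32` discharged by `three_imp_two_of_facts`.  Every input is
a catalogued named fact of the tree except the printed `5`-adic lifting statement `hlift`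
(CDT Thm. 7.2.2, proof, pp. 553–554).  Compare
`exists_isNewformOf_of_wild_of_auxiliaryCurve_of_CDT721_lift_723_of_swan_of_facts`
(`CDTTheorem722Proofs`: Theorem B decomposed, Ogg's formula at `ℓ = 5` in wild form).
[cite: BCDTJAMS2001, Theorem A; Introduction (proof of Theorem A, cases 1–3; (3) ⇒ (2))] -/
theorem exists_isNewformOf_of_theoremB_of_CDT721_lift_723_of_ogg3two_of_facts (hB : theoremB)
    (h721 : CDT_theorem_7_2_1)
    (hlift : ∀ (W : WeierstrassCurve ℚ) [W.IsElliptic] (ρ : ModPGaloisRep ℚ (ZMod 5) 2),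
      W.IsTorsionGaloisRep 5 ρ → ρ.IsAbsIrreducibleOverSqrt 5 → ρ.IsModular →
      W.IsModularGaloisRepTate 5)
    (hL : ∀ (N : ℕ) [NeZero N], DeligneSerre1974_span_integralLattice1 N 2)
    (hES : eichlerShimuraConstruction)
    (hF : WeierstrassCurve.isIsogenous_iff_frobeniusTrace_eq)
    (hC : ∀ (N : ℕ) [NeZero N], IsNewformOf.level_eq_conductorNorm (N := N))
    (h723 : CDT_lemma_7_2_3_isModular)
    (hOgg3two : ∀ W : WeierstrassCurve ℚ,
      W.swanConductorAt_rationalTate_eq_wildConductorExponent_of_ringChar_eq_three 2) :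
    EllipticCurves.ModularForms.exists_isNewformOf :=
  exists_isNewformOf_of_theoremB_of_CDT721_lift_32_723_of_ogg3two hB h721 hlift
    (three_imp_two_of_facts hL hES hF hC) h723 hOgg3two

/-! ## Theorem B replaced by Serre's conjecture at `p = 5` -/

/-- **Theorem A from Serre's conjecture (3.2.3) at `p = 5` in place of Theorem B**, with the same
finer inputs (CDT Thm. 7.2.1, the `5`-adic lifting step of Thm. 7.2.2, the four classical facts
behind (3) ⇒ (2), Lemma 7.2.3, Ogg's formula for `V₂` at `p = 3`): Theorem B is the case `p = 5`,
`k = 𝔽₅` of the named fact `exists_newform_of_odd_irreducible` (`SerreConjecture`; Serre (3.2.3),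
Khare–Wintenberger 2009, Thm. 1.2) by `theoremB_of_exists_newform_of_odd_irreducible`
(`BCDTModularitySerreProofs`; BCDT, Introduction: *"Serre had earlier conjectured that ["`ρ̄`
irreducible ⇒ `ρ̄` modular"] holds"*). [cite: BCDTJAMS2001, Introduction; Theorem A] -/
theorem exists_isNewformOf_of_serre_of_CDT721_lift_723_of_ogg3two_of_facts
    (hSerre : ∀ (k : Type) [Field k] [TopologicalSpace k] [DiscreteTopology k],
      exists_newform_of_odd_irreducible (p := 5) (k := k))
    (h721 : CDT_theorem_7_2_1)
    (hlift : ∀ (W : WeierstrassCurve ℚ) [W.IsElliptic] (ρ : ModPGaloisRep ℚ (ZMod 5) 2),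
      W.IsTorsionGaloisRep 5 ρ → ρ.IsAbsIrreducibleOverSqrt 5 → ρ.IsModular →
      W.IsModularGaloisRepTate 5)
    (hL : ∀ (N : ℕ) [NeZero N], DeligneSerre1974_span_integralLattice1 N 2)
    (hES : eichlerShimuraConstruction)
    (hF : WeierstrassCurve.isIsogenous_iff_frobeniusTrace_eq)
    (hC : ∀ (N : ℕ) [NeZero N], IsNewformOf.level_eq_conductorNorm (N := N))
    (h723 : CDT_lemma_7_2_3_isModular)
    (hOgg3two : ∀ W : WeierstrassCurve ℚ,
      W.swanConductorAt_rationalTate_eq_wildConductorExponent_of_ringChar_eq_three 2) :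
    EllipticCurves.ModularForms.exists_isNewformOf :=
  exists_isNewformOf_of_theoremB_of_CDT721_lift_723_of_ogg3two_of_facts
    (theoremB_of_exists_newform_of_odd_irreducible hSerre) h721 hlift hL hES hF hC h723 hOgg3two

end Literature.NumberTheory.Automorphic.BCDT

namespace Literature.NumberTheory.Automorphic

open WeierstrassCurve GaloisRepresentations EllipticCurves EllipticCurves.ModularForms

/-! ## lang.S33 with Theorem B granted and (3) ⇒ (2) proved: no switch, no auxiliary curve -/

/-- **lang.S33 from Theorem B, CDT Thm. 7.2.1, the `5`-adic lifting step of CDT Thm. 7.2.2, the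
four classical facts behind (3) ⇒ (2) (Deligne–Serre (2.7.2) in weight `2`, Eichler–Shimura,
Faltings, Carayol), CDT Lemma 7.2.3 (modularity) and Ogg's formula for the `2`-adic Tate module at
the additive places of residue characteristic `3`** — by the three cases of BCDT's Introduction:
granted those inputs, every integral Weierstrass model `E` with `Δ_E ≠ 0` has a level `N ≥ 1` and a
cusp form `f ∈ S₂(Γ₀(N))` with `a_p(f) = p + 1 - #E(𝔽_p)` for every prime `p ∤ N Δ_E`
(`exists_cuspForm_coeff_eq_frobeniusTrace_of_exists_isNewformOf`, `LangWave0Proofs` Part 2, applied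
to `BCDT.exists_isNewformOf_of_theoremB_of_CDT721_lift_723_of_ogg3two_of_facts`).  Compare
`exists_cuspForm_coeff_eq_frobeniusTrace_of_theoremB_of_CDT721_lift_32_723_of_ogg3two`
(`BCDTTheoremACasesOggTwoProofs`), which carries (3) ⇒ (2) as the bare hypothesis `h32`.
[cite: BCDTJAMS2001, Theorem A; Introduction (proof of Theorem A, cases 1–3; (3) ⇒ (2))] -/
theorem exists_cuspForm_coeff_eq_frobeniusTrace_of_theoremB_of_CDT721_lift_723_of_ogg3two_of_facts
    (hB : BCDT.theoremB) (h721 : BCDT.CDT_theorem_7_2_1)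
    (hlift : ∀ (W : WeierstrassCurve ℚ) [W.IsElliptic] (ρ : ModPGaloisRep ℚ (ZMod 5) 2),
      W.IsTorsionGaloisRep 5 ρ → ρ.IsAbsIrreducibleOverSqrt 5 → ρ.IsModular →
      W.IsModularGaloisRepTate 5)
    (hL : ∀ (N : ℕ) [NeZero N], DeligneSerre1974_span_integralLattice1 N 2)
    (hES : eichlerShimuraConstruction)
    (hF : WeierstrassCurve.isIsogenous_iff_frobeniusTrace_eq)
    (hC : ∀ (N : ℕ) [NeZero N], IsNewformOf.level_eq_conductorNorm (N := N))
    (h723 : BCDT.CDT_lemma_7_2_3_isModular)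
    (hOgg3two : ∀ W : WeierstrassCurve ℚ,
      W.swanConductorAt_rationalTate_eq_wildConductorExponent_of_ringChar_eq_three 2) :
    exists_cuspForm_coeff_eq_frobeniusTrace :=
  exists_cuspForm_coeff_eq_frobeniusTrace_of_exists_isNewformOf
    (BCDT.exists_isNewformOf_of_theoremB_of_CDT721_lift_723_of_ogg3two_of_facts hB h721 hlift hL hES
      hF hC h723 hOgg3two)

/-- **lang.S33, `L`-series form** (`exists_cuspForm_qExpansion_coeff_eq_lFunction`: some
`f ∈ S₂(Γ₀(N))`, `N ≥ 1`, with `aₙ(f) = aₙ(E)` for all `n`) **from the same inputs**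
(`exists_cuspForm_qExpansion_coeff_eq_lFunction_of_exists_isNewformOf`, `LangWave0Proofs` Part 4,
applied to `BCDT.exists_isNewformOf_of_theoremB_of_CDT721_lift_723_of_ogg3two_of_facts`).
[cite: BCDTJAMS2001, Theorem A and Introduction (2)] -/
theorem
    exists_cuspForm_qExpansion_coeff_eq_lFunction_of_theoremB_of_CDT721_lift_723_of_ogg3two_of_facts
    (hB : BCDT.theoremB) (h721 : BCDT.CDT_theorem_7_2_1)
    (hlift : ∀ (W : WeierstrassCurve ℚ) [W.IsElliptic] (ρ : ModPGaloisRep ℚ (ZMod 5) 2),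
      W.IsTorsionGaloisRep 5 ρ → ρ.IsAbsIrreducibleOverSqrt 5 → ρ.IsModular →
      W.IsModularGaloisRepTate 5)
    (hL : ∀ (N : ℕ) [NeZero N], DeligneSerre1974_span_integralLattice1 N 2)
    (hES : eichlerShimuraConstruction)
    (hF : WeierstrassCurve.isIsogenous_iff_frobeniusTrace_eq)
    (hC : ∀ (N : ℕ) [NeZero N], IsNewformOf.level_eq_conductorNorm (N := N))
    (h723 : BCDT.CDT_lemma_7_2_3_isModular)
    (hOgg3two : ∀ W : WeierstrassCurve ℚ,
      W.swanConductorAt_rationalTate_eq_wildConductorExponent_of_ringChar_eq_three 2) :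
    exists_cuspForm_qExpansion_coeff_eq_lFunction :=
  exists_cuspForm_qExpansion_coeff_eq_lFunction_of_exists_isNewformOf
    (BCDT.exists_isNewformOf_of_theoremB_of_CDT721_lift_723_of_ogg3two_of_facts hB h721 hlift hL hES
      hF hC h723 hOgg3two)

/-- **lang.S33 from Serre's conjecture (3.2.3) at `p = 5`, CDT Thm. 7.2.1, the `5`-adic lifting
step of Thm. 7.2.2, the four classical facts behind (3) ⇒ (2), Lemma 7.2.3 (modularity) and Ogg's
formula for `V₂` at `p = 3`** (Theorem B replaced by Serre–Khare–Wintenberger at `p = 5`,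
`BCDT.exists_isNewformOf_of_serre_of_CDT721_lift_723_of_ogg3two_of_facts`).
[cite: BCDTJAMS2001, Theorem A; Introduction] -/
theorem exists_cuspForm_coeff_eq_frobeniusTrace_of_serre_of_CDT721_lift_723_of_ogg3two_of_facts
    (hSerre : ∀ (k : Type) [Field k] [TopologicalSpace k] [DiscreteTopology k],
      exists_newform_of_odd_irreducible (p := 5) (k := k))
    (h721 : BCDT.CDT_theorem_7_2_1)
    (hlift : ∀ (W : WeierstrassCurve ℚ) [W.IsElliptic] (ρ : ModPGaloisRep ℚ (ZMod 5) 2),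
      W.IsTorsionGaloisRep 5 ρ → ρ.IsAbsIrreducibleOverSqrt 5 → ρ.IsModular →
      W.IsModularGaloisRepTate 5)
    (hL : ∀ (N : ℕ) [NeZero N], DeligneSerre1974_span_integralLattice1 N 2)
    (hES : eichlerShimuraConstruction)
    (hF : WeierstrassCurve.isIsogenous_iff_frobeniusTrace_eq)
    (hC : ∀ (N : ℕ) [NeZero N], IsNewformOf.level_eq_conductorNorm (N := N))
    (h723 : BCDT.CDT_lemma_7_2_3_isModular)
    (hOgg3two : ∀ W : WeierstrassCurve ℚ,
      W.swanConductorAt_rationalTate_eq_wildConductorExponent_of_ringChar_eq_three 2) :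
    exists_cuspForm_coeff_eq_frobeniusTrace :=
  exists_cuspForm_coeff_eq_frobeniusTrace_of_exists_isNewformOf
    (BCDT.exists_isNewformOf_of_serre_of_CDT721_lift_723_of_ogg3two_of_facts hSerre h721 hlift hL
      hES hF hC h723 hOgg3two)

end Literature.NumberTheory.Automorphic

end
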